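import Summits.Ventures.HodgeRepro2.T5BergmanSchurPolarizedU11
import Summits.Ventures.HodgeRepro2.T5BergmanSchurRuhl

/-!
# The matrix coefficients of an orthonormal basis are an orthogonal system in `L²(G)`

The classical form of the Schur orthogonality relations for a discrete series representation: for
an orthonormal basis `(e_n)` of the representation space, the functions `g ↦ ⟨π(g) e_m, e_n⟩` are
pairwise orthogonal in `L²(G)` and all have the same norm `1/√d(π)`. Here the basis is Rühl's
`Φ_q = N_q^k w^{q-k}` (`T5BergmanMonomialNorm.ruhlBasis k n`, orthonormal for Rühl's inner product
`(·,·) = (k-1)/π ⟨·,·⟩_k`, so `⟨e_n, e_n⟩_k = π/(k-1)`), the representation is the weight-`k` Bergman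
model and the measure is `μ_R = ν/π`:

* `integral_basis_coeff_mul_conj`:
  `∫_G ⟨π_k(g) e_m, e_n⟩_k conj ⟨π_k(g) e_{m'}, e_{n'}⟩_k dμ_R = δ_{m m'} δ_{n n'} (π/(k-1))² / (k-1)`;
* in Rühl's normalisation (`integral_ruhlInner_basis_act_mul_conj`):
  `∫_G (e_n, T_g e_m) conj (e_{n'}, T_g e_{m'}) dμ_R = δ_{m m'} δ_{n n'} / (2 k_R - 1)`
  (the diagonal is `T5BergmanSchurRuhl.integral_norm_ruhlInner_basis_act_sq`);
* on `H_j = U(1,1)` against every Haar measure (`integral_basis_coeffU_mul_conj`).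

Blind lane: Mathlib + the HodgeRepro2 prefix only; no sorry; axioms ⊆ {propext, Classical.choice,
Quot.sound}.
-/

namespace Summit.Ventures.HodgeRepro2.T5BergmanSchurBasis

open MeasureTheory MeasureTheory.Measure Metric Filter Topology
open T5PoincareMeasure T5SU11Unimodular T5U11Unimodular T5U11Product T5SU11Fibration
  T5SU11FibrationHaar T5HaarCircle T5SU11CoefficientL2 T5U11CoefficientL2
open T5BergmanCoefficient T5BergmanPairing T5BergmanUnitary T5BergmanFourier T5BergmanParseval
  T5BergmanRuhlModel T5BergmanMonomialNorm T5BergmanMatrixCoeff T5BergmanSchurGeneral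
  T5BergmanSchurPolarized T5BergmanSchurGeneralU11 T5BergmanSchurPolarizedU11 T5BergmanSchurRuhl
open scoped Real

/-! ### Rühl's basis in the Bergman pairing -/

/-- `⟨e_n, e_n⟩_k = π/(k-1)`. -/
theorem pairing_ruhlBasis_self (k : ℕ) (hk : 2 ≤ k) (n : ℕ) :
    pairing k (ruhlBasis k n) (ruhlBasis k n) = ((π / ((k : ℝ) - 1) : ℝ) : ℂ) := by
  have h := ruhlInner_basis_self k hk n
  unfold ruhlInner at h
  have hk1 : ((k : ℝ) - 1) ≠ 0 := by
    have : (2 : ℝ) ≤ k := by exact_mod_cast hk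
    intro h0
    linarith
  have hπ : (π : ℝ) ≠ 0 := Real.pi_ne_zero
  have hc : ((((k : ℝ) - 1) / π : ℝ) : ℂ) ≠ 0 := by
    rw [Ne, Complex.ofReal_eq_zero]
    exact div_ne_zero hk1 hπ
  have e : pairing k (ruhlBasis k n) (ruhlBasis k n) =
      ((((k : ℝ) - 1) / π : ℝ) : ℂ)⁻¹ * 1 := by
    rw [← h, ← mul_assoc, inv_mul_cancel₀ hc, one_mul]
  rw [e, mul_one, ← Complex.ofReal_inv, inv_div]

/-- `⟨e_n, e_m⟩_k = 0` for `n ≠ m`. -/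
theorem pairing_ruhlBasis_eq_zero (k : ℕ) (hk : 2 ≤ k) {n m : ℕ} (hnm : n ≠ m) :
    pairing k (ruhlBasis k n) (ruhlBasis k m) = 0 := by
  have h := ruhlInner_basis_eq_zero k hk (Ne.symm hnm)
  unfold ruhlInner at h
  have hk1 : ((k : ℝ) - 1) ≠ 0 := by
    have : (2 : ℝ) ≤ k := by exact_mod_cast hk
    intro h0
    linarith
  have hπ : (π : ℝ) ≠ 0 := Real.pi_ne_zero
  have hc : ((((k : ℝ) - 1) / π : ℝ) : ℂ) ≠ 0 := by
    rw [Ne, Complex.ofReal_eq_zero]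
    exact div_ne_zero hk1 hπ
  exact (mul_eq_zero.mp h).resolve_left hc

/-- `⟨e_n, e_m⟩_k = δ_{n m} π/(k-1)`. -/
theorem pairing_ruhlBasis (k : ℕ) (hk : 2 ≤ k) (n m : ℕ) :
    pairing k (ruhlBasis k n) (ruhlBasis k m) =
      if n = m then ((π / ((k : ℝ) - 1) : ℝ) : ℂ) else 0 := by
  split_ifs with h
  · subst h
    exact pairing_ruhlBasis_self k hk n
  · exact pairing_ruhlBasis_eq_zero k hk h

/-- `(e_n, T_g e_m) = (k-1)/π ⟨π_k(g) e_m, e_n⟩_k`. -/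
lemma ruhlInner_basis_act (k : ℕ) (g : SU11) (m n : ℕ) :
    ruhlInner k (ruhlBasis k n) (act k g (ruhlBasis k m)) =
      ((((k : ℝ) - 1) / π : ℝ) : ℂ) * matrixCoeff k (ruhlBasis k m) (ruhlBasis k n) g := rfl

variable [MeasurableSpace Circle] [BorelSpace Circle]

/-! ### The orthogonal system in `L²(G, μ_R)` -/

/-- **The coefficients of the basis are an orthogonal system in `L²(G, μ_R)`**:
`∫_G ⟨π_k(g) e_m, e_n⟩_k conj ⟨π_k(g) e_{m'}, e_{n'}⟩_k dμ_R = δ_{m m'} δ_{n n'} (π/(k-1))²/(k-1)`. -/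
theorem integral_basis_coeff_mul_conj (k : ℕ) (hk : 2 ≤ k) (m n m' n' : ℕ) :
    ∫ g, matrixCoeff k (ruhlBasis k m) (ruhlBasis k n) g *
      (starRingEnd ℂ) (matrixCoeff k (ruhlBasis k m') (ruhlBasis k n') g) ∂ruhl =
      if m = m' ∧ n = n' then (((π / ((k : ℝ) - 1)) ^ 2 / ((k : ℝ) - 1) : ℝ) : ℂ) else 0 := by
  rw [schur_relations k hk _ _ _ _ (differentiableOn_ruhlBasis k m) (integrableOn_ruhlBasis k m)
    (differentiableOn_ruhlBasis k m') (integrableOn_ruhlBasis k m') (differentiableOn_ruhlBasis k n)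
    (integrableOn_ruhlBasis k n) (differentiableOn_ruhlBasis k n') (integrableOn_ruhlBasis k n'),
    pairing_ruhlBasis k hk m m', pairing_ruhlBasis k hk n' n]
  by_cases hm : m = m'
  · by_cases hn : n = n'
    · rw [if_pos hm, if_pos (hn.symm), if_pos ⟨hm, hn⟩]
      push_cast
      ring
    · rw [if_pos hm, if_neg (show ¬ n' = n from fun h => hn h.symm), mul_zero, zero_div,
        if_neg (fun h => hn h.2)]
  · rw [if_neg hm, zero_mul, zero_div, if_neg (fun h => hm h.1)]

/-- The constant norm: `∫_G |⟨π_k(g) e_m, e_n⟩_k|² dμ_R = (π/(k-1))²/(k-1)` for every `m, n`. -/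
theorem integral_norm_basis_coeff_sq (k : ℕ) (hk : 2 ≤ k) (m n : ℕ) :
    ∫ g, ‖matrixCoeff k (ruhlBasis k m) (ruhlBasis k n) g‖ ^ 2 ∂ruhl =
      (π / ((k : ℝ) - 1)) ^ 2 / ((k : ℝ) - 1) := by
  have h := (integral_norm_matrixCoeff_sq_ruhl k hk _ (ruhlBasis k m) (differentiableOn_ruhlBasis k m)
    (hasSum_taylor _ (differentiableOn_ruhlBasis k m)) (integrableOn_ruhlBasis k m) _ (ruhlBasis k n)
    (hasSum_taylor _ (differentiableOn_ruhlBasis k n)) (integrableOn_ruhlBasis k n)).2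
  rw [h, pairing_ruhlBasis_self k hk m, pairing_ruhlBasis_self k hk n, Complex.ofReal_re]
  ring

/-! ### Rühl's normalisation -/

/-- **Rühl's `(5-99)` off the diagonal**:
`∫_G (e_n, T_g e_m) conj (e_{n'}, T_g e_{m'}) dμ_R = δ_{m m'} δ_{n n'} / (2 k_R - 1)`. -/
theorem integral_ruhlInner_basis_act_mul_conj (k : ℕ) (hk : 2 ≤ k) (m n m' n' : ℕ) :
    ∫ g, ruhlInner k (ruhlBasis k n) (act k g (ruhlBasis k m)) *
      (starRingEnd ℂ) (ruhlInner k (ruhlBasis k n') (act k g (ruhlBasis k m'))) ∂ruhl =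
      if m = m' ∧ n = n' then ((1 / ((k : ℝ) - 1) : ℝ) : ℂ) else 0 := by
  have hk1 : ((k : ℝ) - 1) ≠ 0 := by
    have : (2 : ℝ) ≤ k := by exact_mod_cast hk
    intro h0
    linarith
  have hπ : (π : ℝ) ≠ 0 := Real.pi_ne_zero
  simp_rw [ruhlInner_basis_act, map_mul, Complex.conj_ofReal]
  have e : ∀ g : SU11, ((((k : ℝ) - 1) / π : ℝ) : ℂ) * matrixCoeff k (ruhlBasis k m) (ruhlBasis k n) g *
      (((((k : ℝ) - 1) / π : ℝ) : ℂ) * (starRingEnd ℂ) (matrixCoeff k (ruhlBasis k m') (ruhlBasis k n') g)) =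
      ((((k : ℝ) - 1) / π : ℝ) : ℂ) ^ 2 * (matrixCoeff k (ruhlBasis k m) (ruhlBasis k n) g *
        (starRingEnd ℂ) (matrixCoeff k (ruhlBasis k m') (ruhlBasis k n') g)) := fun g => by ring
  simp_rw [e]
  rw [integral_const_mul, integral_basis_coeff_mul_conj k hk m n m' n']
  split_ifs
  · push_cast
    field_simp
  · rw [mul_zero]

/-! ### On `H_j = U(1,1)` -/

variable [MeasurableSpace U11] [BorelSpace U11]

/-- **On `U(1,1)`, against every Haar measure `μ_U`**:
`c_U • ∫_{U(1,1)} ⟨π_k(g) e_m, e_n⟩_k conj ⟨π_k(g) e_{m'}, e_{n'}⟩_k dμ_U = δ_{m m'} δ_{n n'} π (π/(k-1))²/(k-1)`. -/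
theorem integral_basis_coeffU_mul_conj (μU : Measure U11) [IsHaarMeasure μU] (k : ℕ) (hk : 2 ≤ k)
    (m n m' n' : ℕ) :
    (haarScalarFactor (map mulHom (haarCircle.prod (nu haarCircle))) μU : ℝ) •
      ∫ g, matrixCoeffU k (ruhlBasis k m) (ruhlBasis k n) g *
        (starRingEnd ℂ) (matrixCoeffU k (ruhlBasis k m') (ruhlBasis k n') g) ∂μU =
      if m = m' ∧ n = n' then ((π * ((π / ((k : ℝ) - 1)) ^ 2 / ((k : ℝ) - 1)) : ℝ) : ℂ) else 0 := by
  rw [integral_matrixCoeffU_mul_conj μU k hk _ _ _ _ (differentiableOn_ruhlBasis k m)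
    (integrableOn_ruhlBasis k m) (differentiableOn_ruhlBasis k n) (integrableOn_ruhlBasis k n)
    (differentiableOn_ruhlBasis k m') (integrableOn_ruhlBasis k m') (differentiableOn_ruhlBasis k n')
    (integrableOn_ruhlBasis k n'), pairing_ruhlBasis k hk m m', pairing_ruhlBasis k hk n' n]
  by_cases hm : m = m'
  · by_cases hn : n = n'
    · rw [if_pos hm, if_pos (hn.symm), if_pos ⟨hm, hn⟩]
      push_cast
      ring
    · rw [if_pos hm, if_neg (show ¬ n' = n from fun h => hn h.symm), mul_zero, zero_div, mul_zero,
        if_neg (fun h => hn h.2)]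
  · rw [if_neg hm, zero_mul, zero_div, mul_zero, if_neg (fun h => hm h.1)]

end Summit.Ventures.HodgeRepro2.T5BergmanSchurBasis
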